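import Literature.IUT.HodgeArakelov.CohomologyAutFunctoriality
import Literature.AnabelianGeometry.EtaleTheta.ThetaKummerDeck
import Literature.AnabelianGeometry.EtaleTheta.ContH1CoeffChange
import HarnessLib

/-!
# [EtTh] Prop. 1.4 (ii) «Θ̈(Ü) = −Θ̈(Ü⁻¹)» at the level of Kummer classes: an automorphism pair `(α, β)`
# (a representative of the inversion `ι`) acts on the pulled-back étale theta class like a deck translate

S. Mochizuki, *The étale theta function …*, Publ. RIMS **45** (2009), Prop. 1.4 (ii) (PRIMS PDF p. 248), first
equation «Θ̈(Ü) = −Θ̈(Ü⁻¹)»; consumed by S. Mochizuki, *Inter-universal Teichmüller theory II* (kurims Dec. 2020),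
Remark 2.1.1 / Prop. 2.2 (ii) p. 66 («the condition of invariance with respect to ι»). Layer L2→L6 junction of the
abc-iut cell; sub-DAG `plan/L2/SUBDAG-EtTh-Prop14.md` row P14/L09, GAP-LEDGER G-w4d010-2 binder **(R2) hroot**:
this file is the `Δ_Θ`-LEVEL SUPPLIER of the hypothesis `hΔ` of abc-iut-w4-d014's transport
`Literature.IUT.HodgeArakelov.ContH1Aut.autMap_eq_conj_of_coeffChange_eq` / `h1TopAut_eq_conj_of_coeffChange_eq`
(p415311), by the Kummer-function route of `ThetaKummerDeck.lean` (p414885, seat abc-iut-w5-d125).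
PROOF-ONLY (no definitions; D-0067): the automorphism pair `(α, β)` (abc-iut-L6-t1 / w4-d025's model of `ι`,
`CohomologyAutFunctoriality.lean` p412635) and every function-level input enter as HYPOTHESES.

* GENERIC `ContH1Aut.autMap_comap_kummerContClass` — for an automorphism pair `(α, β)` on a group `G₀` over
  `ι : G₀ → G` (`β ∘ (φ∘ι) = (φ∘ι) ∘ α`, `β(A′) ⊆ A′`) and a PULL-BACK OF FUNCTIONS `ιFn : A →* A` that is
  `α`-twisted-equivariant (`ιFn ((ι g) • f) = ι (α g) • ιFn f`) and compatible with the coefficients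
  (`β ∘ c = c ∘ Λ(ιFn)` on `Λ(A) → A′`): `autMap (comap κ(x)) = comap κ(x.map ιFn)` — transport of structure of
  continuous Kummer classes along automorphisms (cocycle-level identity; the inner case is
  `CyclotomeCoefficients.conj_kummerContClass`, p413781). [cite: NeukirchSchmidtWingberg2008, I §5]
* `ThetaKummerInput.autMap_comap_kummerTheta` — with the function-level first equation of Prop. 1.4 (ii)
  «`ιFn Θ̈ = const(−1) · Θ̈`» (the inversion `Ü ↦ Ü⁻¹` pulls `Θ̈` back to `−Θ̈`): the pair carries the pulled-back
  class `comap κ(Θ̈)` to `comap (κ(−1) · κ(Θ̈))`;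
* `ThetaKummerInput.autMap_comap_kummerTheta_eq_conj` — adding the deck hypothesis `hdeck` of
  `ThetaKummerDeck.lean` («Θ̈(−Ü) = −Θ̈(Ü)») and an element `ε₀ ∈ G₀` over `Π^tp_Y ∖ Π^tp_Ÿ`:
  `autMap (comap κ(Θ̈)) = conj ε₀ (comap κ(Θ̈))` (via `ContH1.comap_conj`, p412729);
* `EtaleThetaData.autMap_comap_etaDd_eq_conj` — THE CONSUMER SHAPE for `η̈^Θ = κ(Θ̈)`: `hΔ` with `τ₀ := ε₀` once the
  consumer rewrites `coeffChange ∘ h1TopAut` (`coeffChange_h1TopAut`, p415311) and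
  `coeffChange (rootLiftClass C) = comap E.etaDd` (abc-iut-L2-t8, `coeffChange_rootLiftClass_eq_comap`).

No statement of [EtTh]/[IUTchII] is asserted; Prop. 1.4 is classical and undisputed; nothing here bears on
[IUTchIII] Cor. 3.12. Universe `Type` as in `Setting.lean`.
-/

noncomputable section

namespace Literature.IUT.HodgeArakelov

open Literature.AnabelianGeometry.EtaleTheta

namespace ContH1Aut

variable {G₀ G G' : Type} [Group G₀] [TopologicalSpace G₀] [Group G] [TopologicalSpace G]
  [SeparatelyContinuousMul G] [Group G'] [TopologicalSpace G'] [IsTopologicalGroup G']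
  {φ : G →* G'} {A' : Subgroup G'} [A'.Normal] [IsMulCommutative A']
  {A : Type} [CommGroup A] [MulDistribMulAction G A] [TopologicalSpace A]

/-- **Automorphism pairs act on pulled-back Kummer classes by pulling back the functions.** For
`(α, β)` an automorphism pair on `G₀` over `ι : G₀ → G` (`β ∘ (φ∘ι) = (φ∘ι) ∘ α`, `β(A′) ⊆ A′`) and a homomorphism
`ιFn : A → A` with `ιFn ((ι g) • f) = ι (α g) • ιFn f` and `β (c ζ) = c (Λ(ιFn) ζ)`: the transport `autMap` of the
pull-back to `H₀` of the Kummer class of the root system `x` of `a` is the pull-back to `H₀'` of the Kummer class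
of the image root system `ιFn ∘ x` of `ιFn a` (here `α⁻¹(H₀') ⊆ H₀`, `ι(H₀), ι(H₀') ⊆ H`).
[cite: NeukirchSchmidtWingberg2008, I §5] -/
theorem autMap_comap_kummerContClass (c : CyclotomeCoefficients φ A' A) (H : Subgroup G) (ι : G₀ →* G)
    (hι : Continuous ι) {H₀ H₀' : Subgroup G₀} (hle : H₀.map ι ≤ H) (hle' : H₀'.map ι ≤ H)
    (α : G₀ ≃ₜ* G₀) (β : G' ≃ₜ* G') (hφ : ∀ g, β ((φ.comp ι) g) = (φ.comp ι) (α g))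
    (hA : ∀ a' : G', a' ∈ A' → β a' ∈ A') (hH : ∀ x, x ∈ H₀' → α.symm x ∈ H₀)
    (ιFn : A →* A) (hιFn : ∀ (g : G₀) (f : A), ιFn (ι g • f) = ι (α g) • ιFn f)
    (hcoeff : ∀ ζ : cyclotome A, coeffMap A' β hA (c.hom ζ) = c.hom (cyclotome.map ιFn ζ))
    {a : A} (x : RootSystem a) (ha : a ∈ MulAction.fixedPoints H A)
    (hx : ∀ n : ℕ+, IsOpen (MulAction.stabilizer G (x.root n) : Set G))
    (ha' : ιFn a ∈ MulAction.fixedPoints H A)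
    (hx' : ∀ n : ℕ+, IsOpen (MulAction.stabilizer G ((x.map ιFn).root n) : Set G)) :
    autMap (φ.comp ι) A' α β hφ hA hH (ContH1.comap φ A' ι hι hle (c.kummerContClass H x ha hx)) =
      ContH1.comap φ A' ι hι hle' (c.kummerContClass H (x.map ιFn) ha' hx') := by
  rw [CyclotomeCoefficients.kummerContClass, CyclotomeCoefficients.kummerContClass, ContH1.comap_mk,
    ContH1.comap_mk, ContH1.mk, ContH1.mk, autMap_mk]
  congr 1
  apply Subtype.ext
  funext h'
  change coeffMap A' β hA (c.hom (x.kummerCocycle ha ⟨ι (α.symm (h' : G₀)), hle ⟨_, hH _ h'.2, rfl⟩⟩)) =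
    c.hom ((x.map ιFn).kummerCocycle ha' ⟨ι (h' : G₀), hle' ⟨_, h'.2, rfl⟩⟩)
  rw [hcoeff]
  congr 1
  refine Subtype.ext (funext fun n => ?_)
  simp only [cyclotome.map_apply, RootSystem.kummerCocycle_apply, RootSystem.map_root, map_div]
  change ιFn (ι (α.symm (h' : G₀)) • x.root n) / ιFn (x.root n) = ι (h' : G₀) • ιFn (x.root n) / ιFn (x.root n)
  rw [hιFn, ContinuousMulEquiv.apply_symm_apply]

end ContH1Aut

end Literature.IUT.HodgeArakelov

namespace Literature.AnabelianGeometry.EtaleTheta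

namespace ThetaSetting

open Literature.IUT.HodgeArakelov

variable {p : ℕ} [Fact p.Prime] {D : ThetaSetting p}

namespace ThetaKummerInput

variable (T : D.ThetaKummerInput)

/-- **«Θ̈(Ü) = −Θ̈(Ü⁻¹)» on Kummer classes.** Over `K ≤ Π^tp_X` with an automorphism pair `(α, β)` on `K`
(compatible with `Π^tp_X ↠ (Π^tp_X)^Θ ⊇ Δ_Θ`) and a pull-back of functions `ιFn` on `Fn` that is `α`-twisted
equivariant and compatible with `Λ(Fn) → Δ_Θ`, the function-level hypothesis `hιθ : ιFn Θ̈ = const(−1) · Θ̈`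
(Prop. 1.4 (ii), first equation, for `ι : Ü ↦ Ü⁻¹`) gives: the pair carries the pulled-back Kummer class of `Θ̈`
(to any `H₀ ≤ K` over `Π^tp_Ÿ` with `α⁻¹(H₀) ⊆ H₀`) to the pull-back of `κ(−1) · κ(Θ̈)`.
[cite: MochizukiEtTh2009, Prop 1.4 (ii) p.22] -/
theorem autMap_comap_kummerTheta {K : Subgroup D.PiTemp} {H₀ : Subgroup K}
    (hle : H₀.map K.subtype ≤ D.GtpYdd) (α : K ≃ₜ* K) (β : D.GtpTheta ≃ₜ* D.GtpTheta)
    (hφ : ∀ g, β ((D.toTheta.comp K.subtype) g) = (D.toTheta.comp K.subtype) (α g))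
    (hA : ∀ a' : D.GtpTheta, a' ∈ D.DeltaTheta → β a' ∈ D.DeltaTheta) (hH : ∀ x, x ∈ H₀ → α.symm x ∈ H₀)
    (ιFn : T.Fn →* T.Fn) (hιFn : ∀ (g : K) (f : T.Fn), ιFn ((g : D.PiTemp) • f) = ((α g : K) : D.PiTemp) • ιFn f)
    (hcoeff : ∀ ζ : cyclotome T.Fn, ContH1Aut.coeffMap D.DeltaTheta β hA (T.coeff.hom ζ) =
      T.coeff.hom (cyclotome.map ιFn ζ))
    (hιθ : ιFn T.theta = T.const (-1) * T.theta) :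
    ContH1Aut.autMap (D.toTheta.comp K.subtype) D.DeltaTheta α β hφ hA hH
        (ContH1.comap D.toTheta D.DeltaTheta K.subtype continuous_subtype_val hle T.kummerTheta) =
      ContH1.comap D.toTheta D.DeltaTheta K.subtype continuous_subtype_val hle
        (T.kummerConst (-1) * T.kummerTheta) := by
  have ha' : ιFn T.theta ∈ MulAction.fixedPoints D.GtpYdd T.Fn := by
    rw [hιθ]; exact T.const_mul_theta_mem (-1)
  rw [← T.kummer_const_mul_theta (-1), kummerConstMulTheta, kummerTheta,
    ContH1Aut.autMap_comap_kummerContClass T.coeff D.GtpYdd K.subtype continuous_subtype_val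
    hle hle α β hφ hA hH ιFn hιFn hcoeff T.thetaRoots T.theta_mem (fun _ => T.isOpen_stabilizer _) ha'
    (fun _ => T.isOpen_stabilizer _)]
  congr 1
  -- the two root systems are root systems of the same element `ιFn Θ̈ = const(−1) · Θ̈`
  have key : ∀ {b : T.Fn} (y : RootSystem b) (hb : b ∈ MulAction.fixedPoints D.GtpYdd T.Fn)
      (_ : b = T.const (-1) * T.theta),
      T.coeff.kummerContClass D.GtpYdd y hb (fun _ => T.isOpen_stabilizer _) =
        T.coeff.kummerContClass D.GtpYdd ((T.constRoots (-1)).mul T.thetaRoots) (T.const_mul_theta_mem (-1))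
          (fun _ => T.isOpen_stabilizer _) := by
    intro b y hb e
    subst e
    exact T.coeff.kummerContClass_eq D.GtpYdd _ _ _ _ _
  exact key _ ha' hιθ

/-- Adding the deck form of the second equation (`hdeck`, as in `ThetaKummerDeck.lean`: every
`ε ∈ Π^tp_Y ∖ Π^tp_Ÿ` pulls `Θ̈` back to `const(−1)·Θ̈`) and ONE element `ε₀ ∈ K` over `Π^tp_Y ∖ Π^tp_Ÿ` (for
`Π^tp_Ÿ ⊴ Π^tp_X`, `H₀ ⊴ K`): **the pair acts on the pulled-back Kummer class of `Θ̈` exactly as the deck translate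
`ε₀`** — the shape of [IUTchII] Prop. 2.2 (ii)'s «invariance with respect to ι» on the `(l·ℤ × μ₂)`-orbit.
[cite: MochizukiEtTh2009, Prop 1.4 (ii) p.22] -/
theorem autMap_comap_kummerTheta_eq_conj [D.GtpYdd.Normal] {K : Subgroup D.PiTemp} {H₀ : Subgroup K} [H₀.Normal]
    (hle : H₀.map K.subtype ≤ D.GtpYdd) (α : K ≃ₜ* K) (β : D.GtpTheta ≃ₜ* D.GtpTheta)
    (hφ : ∀ g, β ((D.toTheta.comp K.subtype) g) = (D.toTheta.comp K.subtype) (α g))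
    (hA : ∀ a' : D.GtpTheta, a' ∈ D.DeltaTheta → β a' ∈ D.DeltaTheta) (hH : ∀ x, x ∈ H₀ → α.symm x ∈ H₀)
    (ιFn : T.Fn →* T.Fn) (hιFn : ∀ (g : K) (f : T.Fn), ιFn ((g : D.PiTemp) • f) = ((α g : K) : D.PiTemp) • ιFn f)
    (hcoeff : ∀ ζ : cyclotome T.Fn, ContH1Aut.coeffMap D.DeltaTheta β hA (T.coeff.hom ζ) =
      T.coeff.hom (cyclotome.map ιFn ζ))
    (hιθ : ιFn T.theta = T.const (-1) * T.theta)
    (hdeck : ∀ ε : D.PiTemp, ε ∈ D.GtpY → ε ∉ D.GtpYdd → ε • T.theta = T.const (-1) * T.theta)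
    (ε₀ : K) (hε₁ : (ε₀ : D.PiTemp) ∈ D.GtpY) (hε₂ : (ε₀ : D.PiTemp) ∉ D.GtpYdd) :
    ContH1Aut.autMap (D.toTheta.comp K.subtype) D.DeltaTheta α β hφ hA hH
        (ContH1.comap D.toTheta D.DeltaTheta K.subtype continuous_subtype_val hle T.kummerTheta) =
      ContH1.conj (D.toTheta.comp K.subtype) D.DeltaTheta ε₀
        (ContH1.comap D.toTheta D.DeltaTheta K.subtype continuous_subtype_val hle T.kummerTheta) := by
  rw [T.autMap_comap_kummerTheta hle α β hφ hA hH ιFn hιFn hcoeff hιθ,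
    ← T.conj_kummerTheta_of_deck hdeck hε₁ hε₂]
  exact ContH1.comap_conj D.toTheta D.DeltaTheta K.subtype continuous_subtype_val hle ε₀ T.kummerTheta

end ThetaKummerInput

namespace EtaleThetaData

variable (T : D.ThetaKummerInput)

/-- **(R2) `hroot` at the `Δ_Θ` level — the consumer shape.** If `η̈^Θ = κ(Θ̈)` (route R-8/R-9 of
`ThetaKummerClass.lean`), then under the hypotheses of `ThetaKummerInput.autMap_comap_kummerTheta_eq_conj` the
automorphism pair `(α, β)` carries the pull-back of `η̈^Θ` to `H₀ ≤ K` to its conjugate by `ε₀ ∈ Π^tp_Y ∖ Π^tp_Ÿ`: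
the input `hΔ` (with `τ₀ := ε₀`) of `Literature.IUT.HodgeArakelov.ContH1Aut.autMap_eq_conj_of_coeffChange_eq` /
`h1TopAut_eq_conj_of_coeffChange_eq` after the consumer's rewrites `coeffChange ∘ h1TopAut = autMap ∘ coeffChange`
and `coeffChange (rootLiftClass) = comap η̈^Θ`. [cite: MochizukiEtTh2009, Prop 1.4 (ii) p.22] -/
theorem autMap_comap_etaDd_eq_conj (E : D.EtaleThetaData) [D.GtpYdd.Normal] (hη : E.etaDd = T.kummerTheta)
    {K : Subgroup D.PiTemp} {H₀ : Subgroup K} [H₀.Normal]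
    (hle : H₀.map K.subtype ≤ D.GtpYdd) (α : K ≃ₜ* K) (β : D.GtpTheta ≃ₜ* D.GtpTheta)
    (hφ : ∀ g, β ((D.toTheta.comp K.subtype) g) = (D.toTheta.comp K.subtype) (α g))
    (hA : ∀ a' : D.GtpTheta, a' ∈ D.DeltaTheta → β a' ∈ D.DeltaTheta) (hH : ∀ x, x ∈ H₀ → α.symm x ∈ H₀)
    (ιFn : T.Fn →* T.Fn) (hιFn : ∀ (g : K) (f : T.Fn), ιFn ((g : D.PiTemp) • f) = ((α g : K) : D.PiTemp) • ιFn f)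
    (hcoeff : ∀ ζ : cyclotome T.Fn, ContH1Aut.coeffMap D.DeltaTheta β hA (T.coeff.hom ζ) =
      T.coeff.hom (cyclotome.map ιFn ζ))
    (hιθ : ιFn T.theta = T.const (-1) * T.theta)
    (hdeck : ∀ ε : D.PiTemp, ε ∈ D.GtpY → ε ∉ D.GtpYdd → ε • T.theta = T.const (-1) * T.theta)
    (ε₀ : K) (hε₁ : (ε₀ : D.PiTemp) ∈ D.GtpY) (hε₂ : (ε₀ : D.PiTemp) ∉ D.GtpYdd) :
    ContH1Aut.autMap (D.toTheta.comp K.subtype) D.DeltaTheta α β hφ hA hH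
        (ContH1.comap D.toTheta D.DeltaTheta K.subtype continuous_subtype_val hle E.etaDd) =
      ContH1.conj (D.toTheta.comp K.subtype) D.DeltaTheta ε₀
        (ContH1.comap D.toTheta D.DeltaTheta K.subtype continuous_subtype_val hle E.etaDd) := by
  rw [hη]
  exact T.autMap_comap_kummerTheta_eq_conj hle α β hφ hA hH ιFn hιFn hcoeff hιθ hdeck ε₀ hε₁ hε₂

/-- The same, packaged as the EXISTENCE of a deck translate `τ₀ ∈ Π^tp_Y` (the literal shape of the binder
`hroot` «∃ τ₀, (τ₀ : Π^tp_X) ∈ Π^tp_Y ∧ (α, β)·η̈ = conj τ₀ η̈», at the `Δ_Θ` level).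
[cite: MochizukiEtTh2009, Prop 1.4 (ii) p.22] -/
theorem exists_autMap_comap_etaDd_eq_conj (E : D.EtaleThetaData) [D.GtpYdd.Normal] (hη : E.etaDd = T.kummerTheta)
    {K : Subgroup D.PiTemp} {H₀ : Subgroup K} [H₀.Normal]
    (hle : H₀.map K.subtype ≤ D.GtpYdd) (α : K ≃ₜ* K) (β : D.GtpTheta ≃ₜ* D.GtpTheta)
    (hφ : ∀ g, β ((D.toTheta.comp K.subtype) g) = (D.toTheta.comp K.subtype) (α g))
    (hA : ∀ a' : D.GtpTheta, a' ∈ D.DeltaTheta → β a' ∈ D.DeltaTheta) (hH : ∀ x, x ∈ H₀ → α.symm x ∈ H₀)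
    (ιFn : T.Fn →* T.Fn) (hιFn : ∀ (g : K) (f : T.Fn), ιFn ((g : D.PiTemp) • f) = ((α g : K) : D.PiTemp) • ιFn f)
    (hcoeff : ∀ ζ : cyclotome T.Fn, ContH1Aut.coeffMap D.DeltaTheta β hA (T.coeff.hom ζ) =
      T.coeff.hom (cyclotome.map ιFn ζ))
    (hιθ : ιFn T.theta = T.const (-1) * T.theta)
    (hdeck : ∀ ε : D.PiTemp, ε ∈ D.GtpY → ε ∉ D.GtpYdd → ε • T.theta = T.const (-1) * T.theta)
    (hK : ∃ ε₀ : K, (ε₀ : D.PiTemp) ∈ D.GtpY ∧ (ε₀ : D.PiTemp) ∉ D.GtpYdd) :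
    ∃ τ₀ : K, (τ₀ : D.PiTemp) ∈ D.GtpY ∧
      ContH1Aut.autMap (D.toTheta.comp K.subtype) D.DeltaTheta α β hφ hA hH
          (ContH1.comap D.toTheta D.DeltaTheta K.subtype continuous_subtype_val hle E.etaDd) =
        ContH1.conj (D.toTheta.comp K.subtype) D.DeltaTheta τ₀
          (ContH1.comap D.toTheta D.DeltaTheta K.subtype continuous_subtype_val hle E.etaDd) := by
  obtain ⟨ε₀, hε₁, hε₂⟩ := hK
  exact ⟨ε₀, hε₁, autMap_comap_etaDd_eq_conj T E hη hle α β hφ hA hH ιFn hιFn hcoeff hιθ hdeck ε₀ hε₁ hε₂⟩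

end EtaleThetaData

end ThetaSetting

end Literature.AnabelianGeometry.EtaleTheta

end
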